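import Mathlib
import HarnessLib
import Literature.Analysis.FluidPDE.SuitableWeak
import Literature.Analysis.FluidPDE.LocalTypeI
import Literature.Analysis.FluidPDE.ClassicalSolution
import Literature.Analysis.FluidPDE.ClassicalSuitable
import Literature.Analysis.FluidPDE.LerayHopf
import Literature.Analysis.FluidPDE.SpaceTimeRescaling
import Literature.Analysis.FluidPDE.NSViscosityRescaling
import Literature.Analysis.FluidPDE.TaoEnstrophyLocalisationProofs
import Summits.NavierStokesRegularity.NavierStokesRegularity.Theorems.QuarterBudgetTraceGradientLsc

/-!
# Route QuarterBudgetTrace, support `BudgetedExtinctApex` (stmt-NavierStokesRegularity-26014) — brick «ZoomBudgetInheritance»,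
# part 2: the quarter-law slab enstrophy budget passes to the weak gradient of a zoom limit

Seat ns-es-p1 g3 (director-ns KEY-NS #81 (1)); planner of record ns-idea-9 g2 (route header, TWO-LAYER PLAN:
«BudgetedExtinctApex ⇐ ZoomBudgetInheritance → ExtinctApexOfFE»).  This is the ONE NEW analytic step of the support.

* `lintegral_Ioo_div_sqrt_sub` — `∫⁻_{(T−ρ²,T)} ofReal(c/√(T−t)) dt = ofReal(2cρ)`.
* `lintegral_frobeniusNormSq_fderiv_slab_le` — classical Leray–Hopf solution at unit viscosity with the quarter law
  `∫⁻|curl u(t)|² ≤ K/√(T−t)` on `[0,T)`: `∫⁻_{(T−ρ²,T)×ℝ³} |∇u|²_F ≤ 2K⁺ρ` for `0 < ρ`, `ρ² ≤ T` (Tonelli; the tree's `div`–`curl`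
  bound `lintegral_frobeniusNormSq_fderiv_le_lintegral_sq_norm_curl`).
* `lintegral_frobeniusNormSq_zoomGradient_le` — SCALE INVARIANCE: the classical gradient `μ²∇u(T+μ²s, x₀+μy)` of the zoom has
  `∫⁻_{(−r²,0)×ℝ³} |·|²_F ≤ 2K⁺ r` whenever `(μ r)² ≤ T` (`setLIntegral_preimage_comp_stAffine`, Jacobian `μ⁵`, `|μ²L|²_F = μ⁴|L|²_F`).
* `slabBudget_of_zoomLimit` — THE BRICK: if `U` is the strong `L³(Q(a))`-limit (every `a`) of the zooms along `μ_j → 0⁺` at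
  `(T, x₀)` and `G` is a weak spatial gradient of `U` on every `Q(a)` with `∫∫_{Q(a)}|G|²_F < ∞`, then
  `∫⁻_{(−r²,0)×ℝ³} ‖G‖ₑ² ≤ 2K⁺ r` for every `r > 0` (part 1 on the exhaustion `(−r²,0) × B(0,m+1)`, monotone convergence
  `setLIntegral_iUnion_of_directed`, `‖L‖² ≤ |L|²_F`).

WHAT THIS IS NOT: not `BudgetedExtinctApex` itself, not a statement about the open cruxes EQL (1574) / NTC (18381), not
Navier–Stokes regularity — a tool about HYPOTHETICAL quarter-law blow-ups.  No summit statement is proved here.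
[folklore; AlbrittonBarker2019 §3; Leray1934 §20]
-/

noncomputable section

-- the summit and its single sub-problem share the name (CONVENTIONS §1), as in every Theorems file
set_option linter.dupNamespace false

namespace Summit.NavierStokesRegularity.NavierStokesRegularity.Theorems.QuarterBudgetTraceZoomBudgetInheritance

open MeasureTheory Set Function Filter Topology TopologicalSpace Metric
open scoped NNReal ENNReal InnerProductSpace RealInnerProductSpace
open Literature.Analysis Literature.Analysis.FluidPDE
open Summit.NavierStokesRegularity.NavierStokesRegularity.Theorems.QuarterBudgetTraceGradientLsc

/-! ### 2. The quarter law bounds the slab gradient energy; scale invariance under the zoom -/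

variable {T : ℝ} {u : ℝ → EuclideanSpace ℝ (Fin 3) → EuclideanSpace ℝ (Fin 3)} {p : ℝ → EuclideanSpace ℝ (Fin 3) → ℝ}

/-- `∫_{T−ρ²}^{T} (T − t)^{−1/2} dt`-bookkeeping: for `0 ≤ c` and `0 < ρ`,
`∫⁻_{(T−ρ², T)} ofReal (c/√(T−t)) dt = ofReal (2 c ρ)`. -/
theorem lintegral_Ioo_div_sqrt_sub {c ρ T : ℝ} (hc : 0 ≤ c) (hρ : 0 < ρ) :
    ∫⁻ t in Ioo (T - ρ ^ 2) T, ENNReal.ofReal (c / Real.sqrt (T - t)) = ENNReal.ofReal (2 * c * ρ) := by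
  have hρ2 : 0 < ρ ^ 2 := by positivity
  have hab : T - ρ ^ 2 ≤ T := by linarith
  -- the real integral on the interval
  have hII : IntervalIntegrable (fun t => (T - t) ^ (-(1 / 2 : ℝ))) volume (T - ρ ^ 2) T := by
    have h := (intervalIntegral.intervalIntegrable_rpow' (a := 0) (b := ρ ^ 2)
      (by norm_num : (-1 : ℝ) < -(1 / 2 : ℝ))).comp_sub_left T
    simp only [sub_zero] at h
    exact h.symm
  have hval : ∫ t in (T - ρ ^ 2)..T, (T - t) ^ (-(1 / 2 : ℝ)) = 2 * ρ := by
    rw [intervalIntegral.integral_comp_sub_left (fun x => x ^ (-(1 / 2 : ℝ))) T, sub_self,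
      show T - (T - ρ ^ 2) = ρ ^ 2 by ring, integral_rpow (Or.inl (by norm_num))]
    rw [show (-(1 / 2 : ℝ)) + 1 = 1 / 2 by norm_num, Real.zero_rpow (by norm_num),
      show (ρ ^ 2) ^ (1 / 2 : ℝ) = ρ by
        rw [← Real.sqrt_eq_rpow, Real.sqrt_sq hρ.le]]
    ring
  -- pass to the lower integral
  have hnn : ∀ t ∈ Ioo (T - ρ ^ 2) T, 0 ≤ c * (T - t) ^ (-(1 / 2 : ℝ)) := fun t ht =>
    mul_nonneg hc (Real.rpow_nonneg (by linarith [ht.2]) _)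
  have hIO : IntegrableOn (fun t => c * (T - t) ^ (-(1 / 2 : ℝ))) (Ioo (T - ρ ^ 2) T) volume := by
    have h1 : IntegrableOn (fun t => (T - t) ^ (-(1 / 2 : ℝ))) (Ioc (T - ρ ^ 2) T) volume :=
      (intervalIntegrable_iff_integrableOn_Ioc_of_le hab).1 hII
    exact (h1.mono_set Ioo_subset_Ioc_self).const_mul c
  have hcongr : ∫⁻ t in Ioo (T - ρ ^ 2) T, ENNReal.ofReal (c / Real.sqrt (T - t)) =
      ∫⁻ t in Ioo (T - ρ ^ 2) T, ENNReal.ofReal (c * (T - t) ^ (-(1 / 2 : ℝ))) := by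
    refine setLIntegral_congr_fun measurableSet_Ioo (fun t ht => ?_)
    have hTt : 0 < T - t := by linarith [ht.2]
    rw [Real.sqrt_eq_rpow, div_eq_mul_inv, ← Real.rpow_neg hTt.le]
  rw [hcongr, ← ofReal_integral_eq_lintegral_ofReal hIO ((ae_restrict_mem measurableSet_Ioo).mono hnn)]
  congr 1
  rw [← integral_Ioc_eq_integral_Ioo, ← intervalIntegral.integral_of_le hab, intervalIntegral.integral_const_mul,
    hval]
  ring

/-- **The quarter law bounds the slab gradient energy.**  For a classical solution at unit viscosity on `[0,T)`,
Leray–Hopf on `[0,T]`, with `∫⁻ |curl u(t)|² ≤ K/√(T−t)` on `[0,T)`: for `0 < ρ` with `ρ² ≤ T`,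
`∫⁻_{(T−ρ²,T)×ℝ³} |∇u|²_F ≤ 2 K⁺ ρ` (Tonelli; `∫|∇u(t)|²_F ≤ ∫|curl u(t)|²` for the divergence-free `L²` slices,
`lintegral_frobeniusNormSq_fderiv_le_lintegral_sq_norm_curl`; `∫_{T−ρ²}^T (T−t)^{-1/2} = 2ρ`). -/
theorem lintegral_frobeniusNormSq_fderiv_slab_le
    (hsol : IsClassicalNSSolutionOn (Ico 0 T) 1 0 u p) (hLH : IsLerayHopfOn T 1 0 (u 0) u)
    {K : ℝ} (hK : ∀ t ∈ Ico 0 T, ∫⁻ x, ‖curl (u t) x‖ₑ ^ 2 ≤ ENNReal.ofReal (K / Real.sqrt (T - t)))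
    {ρ : ℝ} (hρ : 0 < ρ) (hρT : ρ ^ 2 ≤ T) :
    ∫⁻ z in Ioo (T - ρ ^ 2) T ×ˢ (univ : Set (EuclideanSpace ℝ (Fin 3))),
        ENNReal.ofReal (frobeniusNormSq (fderiv ℝ (u z.1) z.2)) ≤ ENNReal.ofReal (2 * max K 0 * ρ) := by
  set I : Set ℝ := Ioo (T - ρ ^ 2) T with hIdef
  have hIsub : I ⊆ Ico 0 T := fun t ht => ⟨by rw [hIdef, mem_Ioo] at ht; linarith [ht.1], ht.2⟩
  have hIo : I ⊆ Ioo 0 T := fun t ht => ⟨by rw [hIdef, mem_Ioo] at ht; nlinarith [ht.1, ht.2, hρ], ht.2⟩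
  -- joint continuity of the gradient on `(0,T) × ℝ³`
  have hsm : ContDiffOn ℝ (⊤ : ℕ∞) (uncurry u) (Ioo 0 T ×ˢ (univ : Set (EuclideanSpace ℝ (Fin 3)))) :=
    hsol.smooth_velocity.mono Ioo_subset_Ico_self
  have hu1 : ContDiffOn ℝ 1 (uncurry u) (Ioo 0 T ×ˢ (univ : Set (EuclideanSpace ℝ (Fin 3)))) :=
    hsm.of_le (by exact_mod_cast le_top)
  have hgc : ContinuousOn (fun z : ℝ × EuclideanSpace ℝ (Fin 3) => fderiv ℝ (u z.1) z.2)
      (Ioo 0 T ×ˢ (univ : Set (EuclideanSpace ℝ (Fin 3)))) :=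
    continuousOn_fderiv_slice_of_contDiffOn hu1 isOpen_Ioo.uniqueDiffOn
  set Fz : ℝ × EuclideanSpace ℝ (Fin 3) → ℝ≥0∞ := fun z => ENNReal.ofReal (frobeniusNormSq (fderiv ℝ (u z.1) z.2))
    with hFz
  have hfrobc : Continuous fun L : EuclideanSpace ℝ (Fin 3) →L[ℝ] EuclideanSpace ℝ (Fin 3) => frobeniusNormSq L := by
    unfold frobeniusNormSq
    fun_prop
  have hFc : ContinuousOn Fz (Ioo 0 T ×ˢ (univ : Set (EuclideanSpace ℝ (Fin 3)))) :=
    ENNReal.continuous_ofReal.comp_continuousOn (hfrobc.comp_continuousOn hgc)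
  have hFae : AEMeasurable Fz ((volume : Measure (ℝ × EuclideanSpace ℝ (Fin 3))).restrict
      (I ×ˢ (univ : Set (EuclideanSpace ℝ (Fin 3))))) :=
    (hFc.mono (prod_mono hIo Subset.rfl)).aemeasurable (measurableSet_Ioo.prod MeasurableSet.univ)
  -- Tonelli
  have hprod : ∫⁻ z in I ×ˢ (univ : Set (EuclideanSpace ℝ (Fin 3))), Fz z =
      ∫⁻ t in I, ∫⁻ x in (univ : Set (EuclideanSpace ℝ (Fin 3))), Fz (t, x) := by
    have h := setLIntegral_prod (μ := (volume : Measure ℝ)) (ν := (volume : Measure (EuclideanSpace ℝ (Fin 3))))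
      (s := I) (t := (univ : Set (EuclideanSpace ℝ (Fin 3)))) Fz (by rw [← Measure.volume_eq_prod]; exact hFae)
    rw [← Measure.volume_eq_prod] at h
    exact h
  -- the slice bound
  have hslice : ∀ t ∈ I, ∫⁻ x in (univ : Set (EuclideanSpace ℝ (Fin 3))), Fz (t, x) ≤
      ENNReal.ofReal (max K 0 / Real.sqrt (T - t)) := by
    intro t ht
    have htI : t ∈ Ico 0 T := hIsub ht
    rw [Measure.restrict_univ]
    have hv2 : ContDiff ℝ 2 (u t) := (hsol.contDiff_velocity htI).of_le (by norm_cast)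
    have hL2 : ∫⁻ x, ‖u t x‖ₑ ^ 2 < ⊤ := by
      have h := lintegral_rpow_enorm_lt_top_of_eLpNorm_lt_top two_ne_zero ENNReal.ofNat_ne_top
        (hLH.memLp t ⟨htI.1, htI.2.le⟩).eLpNorm_lt_top
      simpa [ENNReal.toReal_ofNat] using h
    calc ∫⁻ x, Fz (t, x) = ∫⁻ x, ENNReal.ofReal (frobeniusNormSq (fderiv ℝ (u t) x)) := rfl
      _ ≤ ∫⁻ x, ‖curl (u t) x‖ₑ ^ 2 :=
          lintegral_frobeniusNormSq_fderiv_le_lintegral_sq_norm_curl hv2 (hsol.divFree t htI) hL2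
      _ ≤ ENNReal.ofReal (K / Real.sqrt (T - t)) := hK t htI
      _ ≤ ENNReal.ofReal (max K 0 / Real.sqrt (T - t)) := by
          gcongr
          exact le_max_left _ _
  calc ∫⁻ z in I ×ˢ (univ : Set (EuclideanSpace ℝ (Fin 3))), Fz z
      = ∫⁻ t in I, ∫⁻ x in (univ : Set (EuclideanSpace ℝ (Fin 3))), Fz (t, x) := hprod
    _ ≤ ∫⁻ t in I, ENNReal.ofReal (max K 0 / Real.sqrt (T - t)) := setLIntegral_mono' measurableSet_Ioo hslice
    _ = ENNReal.ofReal (2 * max K 0 * ρ) := lintegral_Ioo_div_sqrt_sub (le_max_right _ _) hρ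

/-- **Scale invariance: the classical gradient of the zoom has slab energy `≤ 2K⁺ r`.**  With `u` as above, `μ > 0`,
`r > 0` and `μ r ≤ √T` (so that the zoomed window `(T − μ²r², T)` lies in `[0,T)`), the field
`G_μ(s,y) = μ² ∇u(T + μ²s, x₀ + μy)` — the classical gradient of the zoom `μ u(T + μ²s, x₀ + μy)` — satisfies
`∫⁻_{(−r²,0)×ℝ³} |G_μ|²_F ≤ 2 K⁺ r` (change of variables `lintegral`/`stAffine`, Jacobian `μ⁵`, `|μ²L|²_F = μ⁴|L|²_F`). -/
theorem lintegral_frobeniusNormSq_zoomGradient_le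
    (hsol : IsClassicalNSSolutionOn (Ico 0 T) 1 0 u p) (hLH : IsLerayHopfOn T 1 0 (u 0) u)
    {K : ℝ} (hK : ∀ t ∈ Ico 0 T, ∫⁻ x, ‖curl (u t) x‖ₑ ^ 2 ≤ ENNReal.ofReal (K / Real.sqrt (T - t)))
    (x₀ : EuclideanSpace ℝ (Fin 3)) {μ r : ℝ} (hμ : 0 < μ) (hr : 0 < r) (hμr : (μ * r) ^ 2 ≤ T) :
    ∫⁻ z in Ioo (-(r ^ 2)) 0 ×ˢ (univ : Set (EuclideanSpace ℝ (Fin 3))),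
        ENNReal.ofReal (frobeniusNormSq
          (((μ * μ) • stPull (μ ^ 2) μ T x₀ (fun t x => fderiv ℝ (u t) x)) z.1 z.2)) ≤
      ENNReal.ofReal (2 * max K 0 * r) := by
  set ρ : ℝ := μ * r with hρdef
  have hρ : 0 < ρ := mul_pos hμ hr
  have hμ2 : 0 < μ ^ 2 := pow_pos hμ 2
  set S : Set (ℝ × EuclideanSpace ℝ (Fin 3)) := Ioo (T - ρ ^ 2) T ×ˢ (univ : Set (EuclideanSpace ℝ (Fin 3)))
    with hSdef
  -- the preimage of the window under the zoom chart
  have hpre : stAffine (μ ^ 2) μ T x₀ ⁻¹' S = Ioo (-(r ^ 2)) 0 ×ˢ (univ : Set (EuclideanSpace ℝ (Fin 3))) := by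
    ext z
    simp only [hSdef, mem_preimage, mem_prod, stAffine_fst, mem_Ioo, mem_univ, and_true]
    constructor
    · rintro ⟨h1, h2⟩
      refine ⟨?_, ?_⟩
      · have : T - ρ ^ 2 < T + μ ^ 2 * z.1 := h1
        rw [hρdef, mul_pow] at this
        nlinarith [this, hμ2]
      · nlinarith [h2, hμ2]
    · rintro ⟨h1, h2⟩
      refine ⟨?_, ?_⟩
      · rw [hρdef, mul_pow]; nlinarith [h1, hμ2]
      · nlinarith [h2, hμ2]
  -- the integrand as a pull-back
  set F : ℝ × EuclideanSpace ℝ (Fin 3) → ℝ≥0∞ := fun w =>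
    ENNReal.ofReal (μ ^ 4) * ENNReal.ofReal (frobeniusNormSq (fderiv ℝ (u w.1) w.2)) with hFdef
  have hint_eq : ∀ z : ℝ × EuclideanSpace ℝ (Fin 3),
      ENNReal.ofReal (frobeniusNormSq
        (((μ * μ) • stPull (μ ^ 2) μ T x₀ (fun t x => fderiv ℝ (u t) x)) z.1 z.2)) =
      F (stAffine (μ ^ 2) μ T x₀ z) := by
    intro z
    simp only [hFdef, Pi.smul_apply, stPull_apply]
    rw [frobeniusNormSq_const_smul, ENNReal.ofReal_mul (by positivity)]
    congr 1
    ring_nf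
  calc ∫⁻ z in Ioo (-(r ^ 2)) 0 ×ˢ (univ : Set (EuclideanSpace ℝ (Fin 3))),
        ENNReal.ofReal (frobeniusNormSq
          (((μ * μ) • stPull (μ ^ 2) μ T x₀ (fun t x => fderiv ℝ (u t) x)) z.1 z.2))
      = ∫⁻ z in stAffine (μ ^ 2) μ T x₀ ⁻¹' S, F (stAffine (μ ^ 2) μ T x₀ z) := by
        rw [hpre]
        exact lintegral_congr fun z => hint_eq z
    _ = ENNReal.ofReal (μ ^ 2 * μ ^ Module.finrank ℝ (EuclideanSpace ℝ (Fin 3)))⁻¹ * ∫⁻ z in S, F z :=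
        setLIntegral_preimage_comp_stAffine hμ2 hμ T x₀ F S
    _ = ENNReal.ofReal (μ ^ 5)⁻¹ * (ENNReal.ofReal (μ ^ 4) *
          ∫⁻ z in S, ENNReal.ofReal (frobeniusNormSq (fderiv ℝ (u z.1) z.2))) := by
        rw [finrank_euclideanSpace_fin, lintegral_const_mul' _ _ ENNReal.ofReal_ne_top]
        congr 2
        ring
    _ ≤ ENNReal.ofReal (μ ^ 5)⁻¹ * (ENNReal.ofReal (μ ^ 4) * ENNReal.ofReal (2 * max K 0 * ρ)) := by
        gcongr
        exact lintegral_frobeniusNormSq_fderiv_slab_le hsol hLH hK hρ (by rw [hρdef]; exact hμr)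
    _ = ENNReal.ofReal (2 * max K 0 * r) := by
        have hμ0 : μ ≠ 0 := hμ.ne'
        rw [← ENNReal.ofReal_mul (by positivity : (0 : ℝ) ≤ μ ^ 4),
          ← ENNReal.ofReal_mul (by positivity : (0 : ℝ) ≤ (μ ^ 5)⁻¹)]
        congr 1
        rw [hρdef]
        field_simp

/-! ### 3. The brick: the slab budget passes to the weak gradient of the zoom limit -/

/-- **ZoomBudgetInheritance.**  Let `(u, p)` be classical on `[0,T)` at unit viscosity, Leray–Hopf on `[0,T]`, with the
quarter law `∫⁻|curl u(t)|² ≤ K/√(T−t)` on `[0,T)`.  Let `μ_j → 0⁺` and let `U` be the strong `L³(Q(a))`-limit, for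
every `a > 0`, of the zooms `μ_j u(T + μ_j² s, x₀ + μ_j y)`; let `G` be a weak spatial gradient of `U` on every `Q(a)` with
`∫∫_{Q(a)} |G|²_F < ∞`.  Then the SLAB ENSTROPHY BUDGET holds for the limit:
`∫⁻_{(−r²,0)×ℝ³} ‖G‖ₑ² ≤ 2 K⁺ r` for every `r > 0` (weak lower semicontinuity on the exhaustion
`(−r²,0) × B(0,m+1)` of the slab, `lintegral_frobeniusNormSq_le_of_tendsto_eLpNorm`; scale invariance of the zooms'
budget, `lintegral_frobeniusNormSq_zoomGradient_le`; monotone convergence; `‖L‖² ≤ |L|²_F`). -/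
theorem slabBudget_of_zoomLimit (hT : 0 < T)
    (hsol : IsClassicalNSSolutionOn (Ico 0 T) 1 0 u p) (hLH : IsLerayHopfOn T 1 0 (u 0) u)
    {K : ℝ} (hK : ∀ t ∈ Ico 0 T, ∫⁻ x, ‖curl (u t) x‖ₑ ^ 2 ≤ ENNReal.ofReal (K / Real.sqrt (T - t)))
    (x₀ : EuclideanSpace ℝ (Fin 3)) {μ : ℕ → ℝ} (hμ : ∀ j, 0 < μ j) (hμ0 : Tendsto μ atTop (𝓝 0))
    {U : ℝ → EuclideanSpace ℝ (Fin 3) → EuclideanSpace ℝ (Fin 3)}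
    {G : ℝ → EuclideanSpace ℝ (Fin 3) → EuclideanSpace ℝ (Fin 3) →L[ℝ] EuclideanSpace ℝ (Fin 3)}
    (hG : ∀ a : ℝ, 0 < a →
      HasWeakSpatialGradientOn (parabolicCylinderOpens a (0 : ℝ × EuclideanSpace ℝ (Fin 3))) U G)
    (hGfin : ∀ a : ℝ, 0 < a →
      ∫⁻ z in parabolicCylinder a (0 : ℝ × EuclideanSpace ℝ (Fin 3)), ENNReal.ofReal (frobeniusNormSq (G z.1 z.2)) < ∞)
    (hconv : ∀ a : ℝ, 0 < a → Tendsto (fun j => eLpNorm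
        (uncurry ((μ j) • stPull ((μ j) ^ 2) (μ j) T x₀ u) - uncurry U) 3
        (volume.restrict (parabolicCylinder a (0 : ℝ × EuclideanSpace ℝ (Fin 3))))) atTop (𝓝 0)) :
    ∀ r : ℝ, 0 < r →
      ∫⁻ z in Ioo (-(r ^ 2)) 0 ×ˢ (univ : Set (EuclideanSpace ℝ (Fin 3))), ‖G z.1 z.2‖ₑ ^ 2 ≤
        ENNReal.ofReal (2 * max K 0 * r) := by
  intro r hr
  set I : Set ℝ := Ioo (-(r ^ 2)) 0 with hIdef
  -- ## the bound in Frobenius form on every bounded piece `I × B(0, m+1)`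
  have hpiece : ∀ m : ℕ, ∫⁻ z in I ×ˢ ball (0 : EuclideanSpace ℝ (Fin 3)) ((m : ℝ) + 1),
      ENNReal.ofReal (frobeniusNormSq (G z.1 z.2)) ≤ ENNReal.ofReal (2 * max K 0 * r) := by
    intro m
    set O : Set (ℝ × EuclideanSpace ℝ (Fin 3)) := I ×ˢ ball (0 : EuclideanSpace ℝ (Fin 3)) ((m : ℝ) + 1) with hOdef
    have hOo : IsOpen O := isOpen_Ioo.prod isOpen_ball
    set Oop : Opens (ℝ × EuclideanSpace ℝ (Fin 3)) := ⟨O, hOo⟩ with hOop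
    -- an enclosing backward cylinder `Q(a)`
    set a : ℝ := ((m : ℝ) + 1) + r with hadef
    have ha : 0 < a := by positivity
    have hOQ : O ⊆ parabolicCylinder a (0 : ℝ × EuclideanSpace ℝ (Fin 3)) := by
      intro z hz
      obtain ⟨hz1, hz2⟩ := mem_prod.1 hz
      rw [hIdef, mem_Ioo] at hz1
      rw [mem_ball] at hz2
      rw [mem_parabolicCylinder]
      have hra : r ^ 2 ≤ a ^ 2 := by
        apply pow_le_pow_left₀ hr.le
        rw [hadef]; linarith [(by positivity : (0 : ℝ) ≤ (m : ℝ) + 1)]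
      refine ⟨⟨?_, ?_⟩, ?_⟩
      · simp only [Prod.fst_zero]; linarith [hz1.1]
      · simp only [Prod.fst_zero]; exact hz1.2
      · simp only [Prod.snd_zero]
        have : (m : ℝ) + 1 ≤ a := by rw [hadef]; linarith
        exact hz2.trans_le this
    have hGuO : HasWeakSpatialGradientOn Oop U G :=
      (hG a ha).mono (show Oop ≤ parabolicCylinderOpens a (0 : ℝ × EuclideanSpace ℝ (Fin 3)) from hOQ)
    have hGu2 : ∫⁻ w in (Oop : Set (ℝ × EuclideanSpace ℝ (Fin 3))), ENNReal.ofReal (frobeniusNormSq (G w.1 w.2)) < ∞ :=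
      lt_of_le_of_lt (lintegral_mono_set hOQ) (hGfin a ha)
    -- the scales are eventually small: `μ_j r < √T`, so the zoomed window lies in `[0, T)`
    obtain ⟨J, hJ⟩ : ∃ J : ℕ, ∀ j, J ≤ j → μ j * r < Real.sqrt T := by
      have hpos : 0 < Real.sqrt T / r := div_pos (Real.sqrt_pos.2 hT) hr
      have hev : ∀ᶠ j in atTop, μ j < Real.sqrt T / r := hμ0 (Iio_mem_nhds hpos)
      obtain ⟨J, hJ⟩ := eventually_atTop.1 hev
      refine ⟨J, fun j hj => ?_⟩
      have := hJ j hj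
      rwa [lt_div_iff₀ hr] at this
    -- the shifted approximants and their classical gradients
    set v : ℕ → ℝ → EuclideanSpace ℝ (Fin 3) → EuclideanSpace ℝ (Fin 3) :=
      fun k => (μ (k + J)) • stPull ((μ (k + J)) ^ 2) (μ (k + J)) T x₀ u with hvdef
    set Gk : ℕ → ℝ → EuclideanSpace ℝ (Fin 3) → EuclideanSpace ℝ (Fin 3) →L[ℝ] EuclideanSpace ℝ (Fin 3) :=
      fun k => (μ (k + J) * μ (k + J)) • stPull ((μ (k + J)) ^ 2) (μ (k + J)) T x₀ (fun t x => fderiv ℝ (u t) x)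
      with hGkdef
    have hsm : ContDiffOn ℝ (⊤ : ℕ∞) (uncurry u) (Ioo 0 T ×ˢ (univ : Set (EuclideanSpace ℝ (Fin 3)))) :=
      hsol.smooth_velocity.mono Ioo_subset_Ico_self
    have hu1 : ContDiffOn ℝ 1 (uncurry u) (Ioo 0 T ×ˢ (univ : Set (EuclideanSpace ℝ (Fin 3)))) :=
      hsm.of_le (by exact_mod_cast le_top)
    set slabOp : Opens (ℝ × EuclideanSpace ℝ (Fin 3)) :=
      ⟨Ioo 0 T ×ˢ (univ : Set (EuclideanSpace ℝ (Fin 3))), isOpen_Ioo.prod isOpen_univ⟩ with hslabOp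
    have hgradu : HasWeakSpatialGradientOn slabOp u (fun t x => fderiv ℝ (u t) x) :=
      hasWeakSpatialGradientOn_of_contDiffOn (S := Ioo 0 T) isOpen_Ioo Subset.rfl hu1
    have hGk : ∀ k, HasWeakSpatialGradientOn Oop (v k) (Gk k) := by
      intro k
      have hμk : 0 < μ (k + J) := hμ _
      have h := hgradu.stRescale (μ (k + J)) (pow_pos hμk 2) hμk T x₀
      refine h.mono ?_
      -- `O ⊆` the preimage of the slab under the zoom chart
      intro z hz
      obtain ⟨hz1, -⟩ := mem_prod.1 hz
      rw [hIdef, mem_Ioo] at hz1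
      have hlt := hJ (k + J) (Nat.le_add_left J k)
      have hsq : (μ (k + J) * r) ^ 2 < T := by
        have h0 : 0 ≤ μ (k + J) * r := by positivity
        calc (μ (k + J) * r) ^ 2 < (Real.sqrt T) ^ 2 := by gcongr
          _ = T := Real.sq_sqrt hT.le
      show stAffine ((μ (k + J)) ^ 2) (μ (k + J)) T x₀ z ∈ Ioo 0 T ×ˢ (univ : Set (EuclideanSpace ℝ (Fin 3)))
      refine mem_prod.2 ⟨⟨?_, ?_⟩, mem_univ _⟩
      · simp only [stAffine_fst]
        rw [mul_pow] at hsq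
        nlinarith [hz1.1, pow_pos hμk 2]
      · simp only [stAffine_fst]
        nlinarith [hz1.2, pow_pos hμk 2]
    have hbound : ∀ k, ∫⁻ w in (Oop : Set (ℝ × EuclideanSpace ℝ (Fin 3))),
        ENNReal.ofReal (frobeniusNormSq (Gk k w.1 w.2)) ≤ ENNReal.ofReal (2 * max K 0 * r) := by
      intro k
      have hμk : 0 < μ (k + J) := hμ _
      have hsq : (μ (k + J) * r) ^ 2 ≤ T := by
        have hlt := hJ (k + J) (Nat.le_add_left J k)
        have h0 : 0 ≤ μ (k + J) * r := by positivity
        calc (μ (k + J) * r) ^ 2 ≤ (Real.sqrt T) ^ 2 := by gcongr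
          _ = T := Real.sq_sqrt hT.le
      refine (lintegral_mono_set (show O ⊆ I ×ˢ (univ : Set (EuclideanSpace ℝ (Fin 3))) from
        prod_mono Subset.rfl (subset_univ _))).trans ?_
      exact lintegral_frobeniusNormSq_zoomGradient_le hsol hLH hK x₀ hμk hr hsq
    have hconvk : Tendsto (fun k => eLpNorm (uncurry (v k) - uncurry U) 3
        (volume.restrict (parabolicCylinder a (0 : ℝ × EuclideanSpace ℝ (Fin 3))))) atTop (𝓝 0) :=
      (hconv a ha).comp (tendsto_add_atTop_nat J)
    exact lintegral_frobeniusNormSq_le_of_tendsto_eLpNorm (Ω := Oop) hOQ hGk hGuO hGu2 hconvk hbound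
  -- ## exhaustion `m → ∞`
  have hmono : Monotone fun m : ℕ => I ×ˢ ball (0 : EuclideanSpace ℝ (Fin 3)) ((m : ℝ) + 1) := by
    intro m n hmn
    exact prod_mono Subset.rfl (ball_subset_ball (by exact_mod_cast Nat.add_le_add_right hmn 1))
  have hU : I ×ˢ (univ : Set (EuclideanSpace ℝ (Fin 3))) =
      ⋃ m : ℕ, I ×ˢ ball (0 : EuclideanSpace ℝ (Fin 3)) ((m : ℝ) + 1) := by
    rw [← prod_iUnion, iUnion_ball_nat_succ]
  have hfrob : ∫⁻ z in I ×ˢ (univ : Set (EuclideanSpace ℝ (Fin 3))), ENNReal.ofReal (frobeniusNormSq (G z.1 z.2)) ≤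
      ENNReal.ofReal (2 * max K 0 * r) := by
    rw [hU, setLIntegral_iUnion_of_directed _ hmono.directed_le]
    exact iSup_le hpiece
  -- ## operator norm versus Frobenius norm
  refine le_trans (lintegral_mono fun z => ?_) hfrob
  rw [← ofReal_norm, ← ENNReal.ofReal_pow (norm_nonneg _)]
  exact ENNReal.ofReal_le_ofReal (sq_opNorm_le_frobeniusNormSq _)

end Summit.NavierStokesRegularity.NavierStokesRegularity.Theorems.QuarterBudgetTraceZoomBudgetInheritance

end
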